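import Literature.MathematicalPhysics.QuantumFieldTheory.Balaban1983to89.B9Eq3153FrakGkPiSupRowClosed
import Literature.MathematicalPhysics.QuantumFieldTheory.Balaban1983to89.B9Eq347GlobalFromLocal

/-!
# `Balaban1983to89.B9Eq347FrakGkPiSupGlobal` — T. Bałaban, *Propagators for lattice gauge theories in a background field*, Commun. Math. Phys. **99** (1985) 389–434
# [Balaban1985BackgroundPropagators] Thm 3.13 p. 426, Thm 3.1 (3.47) p. 398 (*«and Lemma 2.1»* of [Balaban1984PropagatorsII]), (3.153) p. 426; [Balaban1985Variational] (117) p. 295: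
# **THE GLOBAL sup → sup BOUND OF PRINT's `𝔊̃_k` ON THE CELL's MODEL, ONE HEIGHT-FREE CONSTANT** — (K85) `exists_local_letter_frakGLatticeKPi` summed over the source blocks by
# ne9-leaf-03's (G) `B9Eq347GlobalFromLocal.norm_apply_le_of_local` (the (E3) ∕ (T4C) pattern): the `L^∞ → L^∞` letter the (117) VALUE member's socket
# `B11Eq117TransformationNormComp.norm_toCLM115_le_of_comp` consumes, now for `𝔊̃_k` itself

statement-level skeleton of published theorems with citation tags; proofs where landed; nothing here is a claim about the Yang–Mills mass gap

CITATION HEADER (lean-in-tree rule).  Audit cell `pub-balaban`, sub-cell `t4`, BINDER row NE9; NE9 crux-team LEAF PROVER 05 (`b2b-balaban-t4-ne9-formalise-leaf-05`, gen 88;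
(K86)).  Composed BY NAME: (K85), (G) `norm_apply_le_of_local`, `torusSum_le`.  Source READ first-hand (`paper:balaban1985-cmp99-background-propagators`, PDF + 388):
pp. 397–398, 426.  [folklore] one summation; NOTHING of print's Thm 3.1 ∕ 3.13 or [B11] (117) is asserted, valued or discharged.
WHAT IS PROVED (sorry-free; no `def`).  **`exists_global_row_frakGLatticeKPi`**: `∃ (α₁, j₁, B)` BEFORE (K80)'s binder block such that for EVERY bond field `f` with
`‖f‖_∞ ≤ M` (`0 ≤ M`) and every bond `b`: `‖(𝔊̃_k f)(b)‖ ≤ B·M` — `B = B_R·K_d(δ)` from (K85)'s `(α₁, j₁, B_R, δ)`.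
HONEST SCOPE.  `hpos′`, `hpos`, `hposπ`, `hQ`, the windows, E162's data, `c₀ = η^d`, `‖J‖ ≤ j₀` stay HYPOTHESES; constants crude; «NE9 ⇐ the named binders»; NE9 NOT
PRINTED ∕ NOT PROVED; row WALLED ON A MODEL (O-NE9-1; #5 UNRULED); spine PROVED 0∕9; rung (B)+1 on a finite T⁴ — NOT infinite volume, NOT mass gap, NOT BetaPertH, NOT
Clay.  HONEST DEPENDENCY: continuum YM on T⁴ ⇐ BetaPertH ∧ nine spine estimates (0/9 proved); BetaPertH ⇐ (D1) ∧ (D4) ∧ CAP+tail; G-an2-4 gates asym, D1 and NE2/3/4.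
NEW file importing (K85) and (G); nothing modified.  Net new unproved facts: 0.
-/

noncomputable section

set_option autoImplicit false

open scoped InnerProductSpace ComplexConjugate BigOperators

namespace Literature.MathematicalPhysics.QuantumFieldTheory.Balaban1983to89.B9Eq347FrakGkPiSupGlobal





open B4Sect5Torus (TSite tdist tdist_nonneg tdist_symm tdist_self tdist_triangle torusSum_le)
open B4Sect5Proof (latticeConst latticeConst_nonneg)
open B9SectCLatticeCarrier (Bond DirPair bpos btgt shift unshift)
open B9Eq311L2Pairing (WL2)
open B9Eq319QprimeTorus (fineP blockCoord)
open B7Prop1Explicit (U1 Wcx boxVec)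
open B11Eq103H1Complex (SiteL2K BondL2K greenK covDerivL2K covDivL2K G1LatticeK KinvLatticeK H1LatticeK H1LatticeK_eq frakGLatticeK)
open B9Eq310DeltaPrime (plaqHolU)
open B9Eq310HessianOperator (adTransportW hessOp)
open B9Eq310HessianHermitian (adTransportW_adjoint)
open B9Eq315QTorus (perCfg cornerSite)
open B9Eq315QTower (towerP UlevOf)
open B9Eq316TowerFlatIsOneStep (towerP_eq_fineP_pow siteCast)
open B9Eq326OperatorTower (QprimeTowerW QkW RofUk laplaceAk G1k)
open B9Eq324DeltaPrimeATower (laplacePrimeAk GpOfUk)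
open B9Eq33CovDerivLocalLetterTower (tdist_bigBlock_bpos_btgt_le_one)
open B9Eq3117GaugeModeStencilLettersTower (local_hessOp_covDerivL2K_tower local_covDivL2K_hessOp_tower)
open B9Eq3130GtildePairRowsClosedTower (exists_local_letters_G1LatticeKPi)
open B9Eq3153FrakGkPiSupRowClosed (exists_local_letter_frakGLatticeKPi)
open B9Eq347GlobalFromLocal (norm_apply_le_of_local)
open B9Eq3119DeltaPiTower (piOfUk laplaceAkPi)

variable {d : ℕ} (hd : 1 ≤ d) (L : ℕ) [NeZero L] (hL : 1 ≤ L) (hL3 : 3 ≤ L)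
  {𝔸 : Type*} [NormedRing 𝔸] [NormedAlgebra ℂ 𝔸] [CompleteSpace 𝔸] [NormOneClass 𝔸] [StarRing 𝔸] [NormedStarGroup 𝔸] [StarModule ℂ 𝔸]
  {W : Type*} [NormedAddCommGroup W] [InnerProductSpace ℂ W] [FiniteDimensional ℂ W] (φ : W ≃ₗ[ℂ] 𝔸)
  {Mφ Mφ' : ℝ} (hMφ : 0 ≤ Mφ) (hMφ' : 0 ≤ Mφ') (hφ : ∀ w, ‖φ w‖ ≤ Mφ * ‖w‖) (hφ' : ∀ X, ‖φ.symm X‖ ≤ Mφ' * ‖X‖) (hstar : ∀ X : 𝔸, ‖star X‖ ≤ ‖X‖)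
  {a : ℝ} (ha : 0 < a) {a' : ℝ} (ha' : 0 < a') {ϱ : ℝ} (hϱ0 : 0 ≤ ϱ) (hϱ1 : ϱ < 1)
  (τ : 𝔸 →ₗ[ℂ] ℂ) {Cτ : ℝ} (hτ : ∀ X, ‖τ X‖ ≤ Cτ * ‖X‖) (hCτ : 0 ≤ Cτ) {Mτ : ℝ} (hτm : ∀ X Y : 𝔸, ‖τ (X * Y)‖ ≤ Mτ * ‖X‖ * ‖Y‖) (hMτ : 0 ≤ Mτ)
  {ρw : ℝ} (hρw : 0 ≤ ρw)
  (hτ₁ : ∀ X : 𝔸, τ (star X) = conj (τ X)) (hτ₂ : ∀ X Y : 𝔸, τ (X * Y) = τ (Y * X)) (hφτ : ∀ X Y : 𝔸, ⟪φ.symm X, φ.symm Y⟫_ℂ = τ (star X * Y))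
  (AQ : ℝ)


set_option maxHeartbeats 400000 in -- margin only: passes at the default 200 000 (cert), but the sibling (K76) sat on the farm's heartbeat cliff (ops-buildfix-2 g21, HOME/INBOX 19:03Z) — same binder block, same shape
include hd hL hL3 hMφ hMφ' hφ hφ' hstar ha ha' hϱ0 hϱ1 hτ hCτ hτm hMτ hρw hτ₁ hτ₂ hφτ in
/-- **THE GLOBAL sup → sup BOUND OF `𝔊̃_k`** — (K85)'s local letter read on the plain bond functions and summed over the source blocks by (G)
`norm_apply_le_of_local` with the row constant `K_d(δ)` (`torusSum_le`). [cite: Balaban1985BackgroundPropagators, Thm 3.13 p.426, Thm 3.1 (3.47) p.398, (3.153) p.426]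
[cite: Balaban1985Variational, (117) p.295] [cite: Balaban1984PropagatorsII, Lemma 2.1 (2.61) p.234] -/
theorem exists_global_row_frakGLatticeKPi :
    ∃ α₁ j₁ B : ℝ, 0 < α₁ ∧ 0 < j₁ ∧ 0 ≤ B ∧
      ∀ (n : ℕ) (η : ℝ) (_hηL : η * (L : ℝ) ^ (n + 1) = 1) (c₀ c₁ : ℝ) [Fact (0 < c₀)] [Fact (0 < c₁)]
        (_hw : c₀ * ((L : ℝ) ^ (n + 1)) ^ d = c₁) (_hρ : |η| ^ d / c₀ ≤ ρw) (m : Fin d → ℕ) [∀ i, NeZero (m i)] (_hm : ∀ i, 1 ≤ m i)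
        (U : Bond d (towerP L m (n + 1)) → 𝔸ˣ) (αU : ℕ → ℝ) (_hα0 : ∀ j, 0 ≤ αU j) (hα1 : ∀ j, αU j ≤ 1 / 64)
        (hαL : ∀ j, 50 * (d + 1) * αU j * (L : ℝ) ^ d ≤ 1 / 2)
        (hU1 : ∀ (j : ℕ) (x : B7Prop1Explicit.Site d) (k : Fin d), perCfg (towerP L m (j + 1)) (UlevOf L m (n + 1) U j) x k ∈ U1 𝔸)
        (hreg : ∀ (j : ℕ) (y : TSite d (towerP L m j)) (k : Fin d) (ρ' : Fin d → Fin L),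
          ‖((Wcx L (perCfg (towerP L m (j + 1)) (UlevOf L m (n + 1) U j)) (cornerSite L y) k (boxVec L ρ') : 𝔸ˣ) : 𝔸) - 1‖ ≤ αU j)
        (εU : ℕ → ℝ) (_hεU : ∀ j, 0 ≤ εU j) (_hUε : ∀ (j : ℕ) (b : Bond d (towerP L m (j + 1))), ‖(UlevOf L m (n + 1) U j b : 𝔸) - 1‖ ≤ εU j)
        (_hLb : ∀ (j : ℕ) (b : Bond d (towerP L m (j + 1))), UlevOf L m (n + 1) U j b ∈ U1 𝔸)
        (α : ℝ) (_hα : 0 ≤ α) (_hαle : α ≤ α₁)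
        (hUst : ∀ b, star (U b : 𝔸) = (((U b)⁻¹ : 𝔸ˣ) : 𝔸)) (_hUb : ∀ b, U b ∈ U1 𝔸) (_hUη : ∀ b, ‖(U b : 𝔸) - 1‖ ≤ α * η)
        (_hpl : ∀ p : B9SectCLatticeCarrier.Plaq d (towerP L m (n + 1)), ‖(plaqHolU U p : 𝔸) - 1‖ ≤ α * η ^ 2)
        (_hUgrad : ∀ (x : TSite d (towerP L m (n + 1))) (μ : Fin d), ‖(U (x, μ) : 𝔸) - U (unshift μ x, μ)‖ ≤ α * η ^ 2)
        (_hRlev : ∀ (j : ℕ) (b : Bond d (towerP L m (j + 1))) (w : W), ‖adTransportW φ (UlevOf L m (n + 1) U j) b w‖ ≤ ‖w‖)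
        (_hεg : ∀ j < n + 1, εU j ≤ α * ϱ ^ j) (_hAQ : ∑ j ∈ Finset.range (n + 1), αU j ≤ AQ)
        (hpos' : ∀ x : SiteL2K ℂ d (towerP L m (n + 1)) c₀ W, x ≠ 0 → 0 < RCLike.re ⟪x, laplacePrimeAk L m n φ η U a' (c₁ := c₁) x⟫_ℂ)
        (hpos : ∀ x : BondL2K ℂ d (towerP L m (n + 1)) c₀ W, x ≠ 0 →
          0 < RCLike.re ⟪x, laplaceAk L m n φ η U hL αU hα1 hU1 hreg τ (c₀ := c₀) (c₁ := c₁) a x⟫_ℂ)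
        (_hc₀η : c₀ = η ^ d) (j₀ : ℝ) (_hJ : ∀ μ y, ‖B9Eq39Adjoint.J (fun μ => B9Eq33CovDerivVector.shiftEquiv μ) (fun μ y => U (y, μ)) η μ y‖ ≤ j₀) (_hj : j₀ ≤ j₁)
        (hposπ : ∀ x : BondL2K ℂ d (towerP L m (n + 1)) c₀ W, x ≠ 0 →
          0 < RCLike.re ⟪x, laplaceAkPi L m n φ τ η U a' hpos' hL αU hα1 hU1 hreg (c₁ := c₁) a x⟫_ℂ)
        (hQ : Function.Surjective (QkW L m n φ U hL αU hα1 hU1 hreg (c₀ := c₀) (c₁ := c₁)))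
        (f : BondL2K ℂ d (towerP L m (n + 1)) c₀ W) (M : ℝ) (_hM : 0 ≤ M)
        (_hfM : ∀ x, ‖WL2.equiv ℂ (fun _ : Bond d (towerP L m (n + 1)) => c₀) W f x‖ ≤ M) (b : Bond d (towerP L m (n + 1))),
        ‖WL2.equiv ℂ (fun _ : Bond d (towerP L m (n + 1)) => c₀) W (frakGLatticeK hposπ hQ f) b‖ ≤ B * M := by
  classical
  obtain ⟨αR, jR, BR, δR, hαR, hjR, hBR, hδR, HR⟩ :=
    exists_local_letter_frakGLatticeKPi hd L hL hL3 φ hMφ hMφ' hφ hφ' hstar ha ha' hϱ0 hϱ1 τ hτ hCτ hτm hMτ hρw hτ₁ hτ₂ hφτ AQ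
  have hK : 0 ≤ latticeConst d δR := latticeConst_nonneg d hδR.le
  refine ⟨αR, jR, BR * latticeConst d δR, hαR, hjR, mul_nonneg hBR hK, ?_⟩
  intro n η hηL c₀ c₁ _ _ hw hρ m _ hm U αU hα0 hα1 hαL hU1 hreg εU hεU hUε hLb α hα hαle hUst hUb hUη hpl hUgrad hRlev hεg hAQ hpos' hpos hc₀η j₀ hJ hj
    hposπ hQ f M hM0 hfM b
  have Hk := HR n η hηL c₀ c₁ hw hρ m hm U αU hα0 hα1 hαL hU1 hreg εU hεU hUε hLb α hα hαle hUst hUb hUη hpl hUgrad hRlev hεg hAQ hpos' hpos hc₀η j₀ hJ hj hposπ hQ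
  -- `𝔊̃_k` read on the plain bond functions
  obtain ⟨TV, hTV⟩ : ∃ T : (Bond d (towerP L m (n + 1)) → W) →ₗ[ℂ] (Bond d (towerP L m (n + 1)) → W),
      ∀ g x, T g x = WL2.equiv ℂ (fun _ : Bond d (towerP L m (n + 1)) => c₀) W
        (frakGLatticeK hposπ hQ ((WL2.equiv ℂ (fun _ : Bond d (towerP L m (n + 1)) => c₀) W).symm g)) x :=
    ⟨(WL2.linearEquiv ℂ ℂ (fun _ : Bond d (towerP L m (n + 1)) => c₀)).toLinearMap ∘ₗ frakGLatticeK hposπ hQ ∘ₗ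
      (WL2.linearEquiv ℂ ℂ (fun _ : Bond d (towerP L m (n + 1)) => c₀)).symm.toLinearMap, fun _ _ => rfl⟩
  have hloc : ∀ (v : TSite d m) (g : Bond d (towerP L m (n + 1)) → W) (F : ℝ),
      (∀ y, blockCoord (L ^ (n + 1)) m (siteCast (towerP_eq_fineP_pow L m (n + 1)) (bpos y)) ≠ v → g y = 0) → (∀ y, ‖g y‖ ≤ F) →
      ∀ x, ‖TV g x‖ ≤ BR * Real.exp (-(δR * tdist m (blockCoord (L ^ (n + 1)) m (siteCast (towerP_eq_fineP_pow L m (n + 1)) (bpos x))) v)) * F := by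
    intro v g F hgv hgF x
    rw [hTV]
    exact Hk v (((WL2.equiv ℂ (fun _ : Bond d (towerP L m (n + 1)) => c₀) W)).symm g) F
      (fun y hy => by rw [Equiv.apply_symm_apply]; exact hgv y hy) (fun y => by rw [Equiv.apply_symm_apply]; exact hgF y) x
  have hV := norm_apply_le_of_local
    (fun y : Bond d (towerP L m (n + 1)) => blockCoord (L ^ (n + 1)) m (siteCast (towerP_eq_fineP_pow L m (n + 1)) (bpos y)))
    (fun x : Bond d (towerP L m (n + 1)) => blockCoord (L ^ (n + 1)) m (siteCast (towerP_eq_fineP_pow L m (n + 1)) (bpos x)))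
    (tdist m) TV hBR hloc (fun u => torusSum_le d hm hδR u) (WL2.equiv ℂ (fun _ : Bond d (towerP L m (n + 1)) => c₀) W f) hM0 hfM b
  rw [hTV, Equiv.symm_apply_apply] at hV
  exact hV

end Literature.MathematicalPhysics.QuantumFieldTheory.Balaban1983to89.B9Eq347FrakGkPiSupGlobal

end
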